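import Mathlib.Analysis.SpecialFunctions.Gamma.Beta
import Mathlib.RingTheory.RootsOfUnity.Complex
import Mathlib.RingTheory.RootsOfUnity.Lemmas
import HarnessLib

/-!
# Gauss's multiplication formula for `Γ` (named fact, discharged)

Topic: `Literature/Analysis/SpecialFunctions`. Vendored for route
`KontsevichZagierPeriods/ExpConservative` (stmt-KontsevichZagierPeriods-0544, -0534; also the
value identity behind Neg 0311/0312): the "Gauss-triplication" beta identity
`B(1/9,4/9)·B(5/9,7/9) = 2·3^{7/6}·π` is the case `n = 3`, `z = 1/9` of the formula below combined
with `Γ(4/3) = Γ(1/3)/3` (`Complex.Gamma_add_one`) and `B(a,b)Γ(a+b) = Γ(a)Γ(b)`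
(`Complex.Gamma_mul_Gamma_eq_betaIntegral`):
`Γ(1/9)Γ(4/9)Γ(7/9) = 2π·3^{1/6}·Γ(1/3)`, hence
`B(1/9,4/9)B(5/9,7/9) = Γ(1/9)Γ(4/9)Γ(7/9)/Γ(4/3) = 6π·3^{1/6} = 2·3^{7/6}π`.

Mathlib status (searched `Gamma_mul_Gamma`, "multiplication formula"): reflection
`Complex.Gamma_mul_Gamma_one_sub` and Legendre duplication `Complex.Gamma_mul_Gamma_add_half`
(the case `n = 2`) are proved; the general `n`-multiplication formula is an explicit TODO in
`Mathlib/Analysis/SpecialFunctions/Gamma/BohrMollerup.lean`. Hence a named fact;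
users take `(h : GaussMultiplicationFormula)` and feed it `GaussMultiplicationFormula_holds`
(proved at the end of this file following Andrews–Askey–Roy §1.5: Bohr–Mollerup for the shape,
reflection + `∏ (1 - ζ^k) = n` for the constant, analytic continuation to `ℂ`).

## Statement as printed

DLMF 5.5.6: `Γ(nz) = (2π)^{(1-n)/2} n^{nz - 1/2} ∏_{k=0}^{n-1} Γ(z + k/n)`, for `nz ≠ 0, -1, -2, …`.
Andrews–Askey–Roy, *Special Functions*, Thm 1.5.2 (Gauss): the same identity in the form
`Γ(ma)(2π)^{(m-1)/2} = m^{ma-1/2} Γ(a)Γ(a+1/m)⋯Γ(a+(m-1)/m)`.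

## Conventions

Complex `Γ` is `Complex.Gamma`; the powers `(2π)^{(1-n)/2}` and `n^{nz-1/2}` have positive real
bases, so the principal-branch `Complex.cpow` is the printed meaning. The pole condition
"`nz ≠ 0, -1, -2, …`" is `∀ m : ℕ, n * z ≠ -m`.

## Sources

* NIST DLMF §5.5(iii), eq. 5.5.6.
* G. E. Andrews, R. Askey, R. Roy, *Special Functions*, Encyclopedia Math. Appl. 71, CUP 1999,
  §1.5, Theorem 1.5.2.
-/

noncomputable section

open scoped Real BigOperators

namespace Literature.Analysis.SpecialFunctions

/-- **Gauss's multiplication formula.** For every integer `n ≥ 1` and `z ∈ ℂ` with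
`nz ∉ {0, -1, -2, …}`:
`Γ(nz) = (2π)^{(1-n)/2} · n^{nz - 1/2} · ∏_{k=0}^{n-1} Γ(z + k/n)`.
[cite: DLMF, 5.5.6] [cite: AndrewsAskeyRoy1999, Thm 1.5.2] -/
def GaussMultiplicationFormula : Prop :=
  ∀ (n : ℕ) (z : ℂ), 1 ≤ n → (∀ m : ℕ, (n : ℂ) * z ≠ -(m : ℂ)) →
    Complex.Gamma (n * z) =
      (2 * (π : ℂ)) ^ ((1 - (n : ℂ)) / 2) * (n : ℂ) ^ ((n : ℂ) * z - 1 / 2) *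
        ∏ k ∈ Finset.range n, Complex.Gamma (z + (k : ℂ) / (n : ℂ))

/-- The case `n = 1` of the multiplication formula is the tautology `Γ(z) = Γ(z)` (sanity check of
the normalisation: `(2π)^0 · 1^{z-1/2} · Γ(z)`). [folklore] -/
theorem gaussMultiplicationFormula_one (z : ℂ) :
    Complex.Gamma (1 * z) =
      (2 * (π : ℂ)) ^ ((1 - ((1 : ℕ) : ℂ)) / 2) * ((1 : ℕ) : ℂ) ^ (((1 : ℕ) : ℂ) * z - 1 / 2) *
        ∏ k ∈ Finset.range 1, Complex.Gamma (z + (k : ℂ) / ((1 : ℕ) : ℂ)) := by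
  simp


/-!
## Proof of the multiplication formula (appended; `GaussMultiplicationFormula_holds`)

We follow Andrews–Askey–Roy, *Special Functions*, §1.5, proof of Theorem 1.5.2 (pp. 22–23) for the
architecture, with the "identity up to a constant" step done via the Bohr–Mollerup theorem exactly as
Mathlib does for Legendre's duplication formula (`Real.doublingGamma`,
`Complex.Gamma_mul_Gamma_add_half`):

1. (`GaussMultiplication.bmFun_eq_Gamma`) for real `s > 0` the function
   `s ↦ n^s ∏_{k<n} Γ(s/n + k/n) / D_n`, `D_n := n ∏_{k<n} Γ(1/n + k/n)`, is log-convex, positive,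
   satisfies `f (s+1) = s f s` and `f 1 = 1`, hence equals `Γ` (Bohr–Mollerup,
   `Real.eq_Gamma_of_log_convex`). This is (1.5.2) with the constant `(2π)^{(n-1)/2} n^{-1/2}`
   replaced by `P := Γ(1/n)⋯Γ((n-1)/n)` (AAR (1.5.3)).
2. (`GaussMultiplication.prod_Gamma_div_sq`) `P² = (2π)^{n-1}/n`: by the reflection formula
   `Γ(k/n)Γ(1-k/n) = π / sin(πk/n)` (`Real.Gamma_mul_Gamma_one_sub`) it suffices that
   `2^{n-1} ∏_{k=1}^{n-1} sin(kπ/n) = n` (`GaussMultiplication.prod_two_mul_sin_pi_div`), which is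
   the norm of `∏_{k=1}^{n-1} (1 - ζ^k) = n`, `ζ = exp(2πi/n)`
   (`IsPrimitiveRoot.prod_one_sub_pow_eq_order`), i.e. `(x^n-1)/(x-1) = ∏ (x - ζ^k)` at `x = 1`.
3. (`GaussMultiplication.complex_inv_formula`) extension to all `z ∈ ℂ` by analytic continuation of
   the entire functions `∏ (Γ(z+k/n))⁻¹` and `Γ(nz)⁻¹ n^{nz} C⁻¹` from the positive real axis.

The complex identity holds unconditionally (both sides vanish at the poles), so the pole hypothesis of
`GaussMultiplicationFormula` is not used.
-/

namespace GaussMultiplication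

open Real Set Filter Topology Finset

/-! ### Step 2a: the sine product -/

/-- `∏_{k=1}^{m} 2 sin(kπ/(m+1)) = m + 1`, from `∏_{k=1}^{m} (1 - ζ^k) = m + 1` for
`ζ = e^{2πi/(m+1)}`. [cite: AndrewsAskeyRoy1999, §1.5, proof of Thm 1.5.2] -/
theorem prod_two_mul_sin_pi_div (m : ℕ) :
    ∏ k ∈ range m, (2 * Real.sin (π * (k + 1) / (m + 1))) = m + 1 := by
  have hμ := Complex.isPrimitiveRoot_exp (m + 1) (Nat.succ_ne_zero m)
  have h := hμ.prod_one_sub_pow_eq_order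
  apply_fun (‖·‖) at h
  rw [norm_prod] at h
  have hnorm : ∀ k ∈ range m,
      ‖1 - Complex.exp (2 * π * Complex.I / ((m + 1 : ℕ) : ℂ)) ^ (k + 1)‖
        = 2 * Real.sin (π * (k + 1) / (m + 1)) := by
    intro k hk
    have hk' : (k + 1 : ℝ) < m + 1 := by exact_mod_cast Nat.succ_lt_succ (mem_range.mp hk)
    rw [norm_sub_rev, ← Complex.exp_nat_mul]
    have : ((k + 1 : ℕ) : ℂ) * (2 * π * Complex.I / ((m + 1 : ℕ) : ℂ))
        = Complex.I * ((2 * π * (k + 1) / (m + 1) : ℝ) : ℂ) := by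
      push_cast; ring
    rw [this, Complex.norm_exp_I_mul_ofReal_sub_one,
      show (2 * π * (k + 1) / (m + 1) : ℝ) / 2 = π * (k + 1) / (m + 1) by ring,
      Real.norm_eq_abs, abs_of_pos]
    refine mul_pos two_pos (Real.sin_pos_of_pos_of_lt_pi (by positivity) ?_)
    rw [div_lt_iff₀ (by positivity)]
    exact mul_lt_mul_of_pos_left hk' Real.pi_pos
  rw [prod_congr rfl hnorm] at h
  rw [h]
  exact_mod_cast Complex.norm_natCast (m + 1)

/-! ### Step 2b: the constant `P = Γ(1/n)⋯Γ((n-1)/n)` -/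

/-- `(∏_{k=1}^{m} Γ(k/(m+1)))² = (2π)^m / (m+1)` (AAR (1.5.3) squared).
[cite: AndrewsAskeyRoy1999, §1.5, (1.5.3)] -/
theorem prod_Gamma_div_sq (m : ℕ) :
    (∏ k ∈ range m, Gamma ((k + 1 : ℝ) / (m + 1))) ^ 2 = (2 * π) ^ m / (m + 1) := by
  set P := ∏ k ∈ range m, Gamma ((k + 1 : ℝ) / (m + 1)) with hP
  have hrefl : ∏ k ∈ range m, Gamma (1 - (k + 1 : ℝ) / (m + 1)) = P := by
    rw [hP, ← prod_range_reflect (fun k : ℕ => Gamma ((k + 1 : ℝ) / (m + 1))) m]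
    refine prod_congr rfl fun k hk => ?_
    have hk := mem_range.mp hk
    have hcast : ((m - 1 - k : ℕ) : ℝ) = m - 1 - k := by
      rw [Nat.sub_sub, Nat.cast_sub (by omega)]; push_cast; ring
    rw [hcast]
    congr 1
    field_simp
    ring
  have hsq : P ^ 2 = ∏ k ∈ range m, (π / Real.sin (π * ((k + 1 : ℝ) / (m + 1)))) := by
    calc P ^ 2 = P * ∏ k ∈ range m, Gamma (1 - (k + 1 : ℝ) / (m + 1)) := by rw [sq, hrefl]
      _ = ∏ k ∈ range m,
            (Gamma ((k + 1 : ℝ) / (m + 1)) * Gamma (1 - (k + 1 : ℝ) / (m + 1))) := by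
          rw [prod_mul_distrib]
      _ = _ := prod_congr rfl fun k _ => by rw [Real.Gamma_mul_Gamma_one_sub]
  have hsin : ∏ k ∈ range m, Real.sin (π * ((k + 1 : ℝ) / (m + 1))) = (m + 1) / 2 ^ m := by
    have h := prod_two_mul_sin_pi_div m
    rw [prod_mul_distrib, prod_const, card_range] at h
    have h' : (∏ k ∈ range m, Real.sin (π * ((k + 1 : ℝ) / (m + 1)))) * 2 ^ m = m + 1 := by
      refine Eq.trans ?_ h
      rw [mul_comm]
      congr 1
      exact prod_congr rfl fun k _ => by rw [mul_div_assoc]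
    rw [eq_div_iff (by positivity), h']
  rw [hsq, prod_div_distrib, prod_const, card_range, hsin, mul_pow]
  field_simp

/-- `∏_{k=1}^{m} Γ(k/(m+1)) = √((2π)^m / (m+1))` (AAR (1.5.3)).
[cite: AndrewsAskeyRoy1999, §1.5, (1.5.3)] -/
theorem prod_Gamma_div_eq (m : ℕ) :
    ∏ k ∈ range m, Gamma ((k + 1 : ℝ) / (m + 1)) = Real.sqrt ((2 * π) ^ m / (m + 1)) := by
  have hpos : 0 < ∏ k ∈ range m, Gamma ((k + 1 : ℝ) / (m + 1)) :=
    prod_pos fun k _ => Gamma_pos_of_pos (by positivity)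
  rw [← prod_Gamma_div_sq, Real.sqrt_sq hpos.le]

/-! ### Step 1: the real formula up to the constant (Bohr–Mollerup) -/

/-- `prodGamma n x = ∏_{k<n} Γ(x + k/n)`, the right-hand product of (1.5.2) for real argument
(auxiliary; `Real.Gamma`). [cite: AndrewsAskeyRoy1999, Thm 1.5.2] -/
def prodGamma (n : ℕ) (x : ℝ) : ℝ := ∏ k ∈ range n, Gamma (x + k / n)

/-- `prodGamma n x > 0` for `x > 0`. [folklore] -/
theorem prodGamma_pos (n : ℕ) {x : ℝ} (hx : 0 < x) : 0 < prodGamma n x :=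
  prod_pos fun k _ => Gamma_pos_of_pos (by positivity)

/-- Functional equation `prodGamma n (x + 1/n) = x · prodGamma n x` (`x > 0`): shifting by `1/n`
permutes the factors cyclically and `Γ(x+1) = xΓ(x)`. [folklore] -/
theorem prodGamma_add_inv {n : ℕ} (hn : n ≠ 0) {x : ℝ} (hx : 0 < x) :
    prodGamma n (x + 1 / n) = x * prodGamma n x := by
  obtain ⟨m, rfl⟩ := Nat.exists_eq_succ_of_ne_zero hn
  set f : ℕ → ℝ := fun k => Gamma (x + k / ((m + 1 : ℕ) : ℝ)) with hf
  have key : (∏ k ∈ range (m + 1), f (k + 1)) * f 0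
      = (∏ k ∈ range (m + 1), f k) * f (m + 1) := by
    rw [← prod_range_succ', prod_range_succ]
  have hf0 : f 0 = Gamma x := by simp [hf]
  have hfn : f (m + 1) = x * Gamma x := by
    simp only [hf]
    rw [show ((m + 1 : ℕ) : ℝ) = ((m.succ : ℕ) : ℝ) from rfl,
      div_self (Nat.cast_ne_zero.mpr hn), Gamma_add_one hx.ne']
  have hL : prodGamma (m + 1) (x + 1 / ((m.succ : ℕ) : ℝ)) = ∏ k ∈ range (m + 1), f (k + 1) := by
    refine prod_congr rfl fun k _ => ?_
    simp only [hf]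
    congr 1
    push_cast
    ring
  rw [hL]
  have hG : Gamma x ≠ 0 := (Gamma_pos_of_pos hx).ne'
  rw [hf0, hfn] at key
  have := mul_right_cancel₀ hG
    (key.trans (by ring : _ = (x * ∏ k ∈ range (m + 1), f k) * Gamma x))
  exact this

/-- The Bohr–Mollerup candidate `s ↦ n^s ∏_{k<n} Γ(s/n + k/n) / (n ∏_{k<n} Γ(1/n + k/n))`
(auxiliary, the analogue of `Real.doublingGamma` for general `n`). [folklore] -/
def bmFun (n : ℕ) (s : ℝ) : ℝ :=
  (n : ℝ) ^ s * prodGamma n (s / n) / (n * prodGamma n (1 / n))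

/-- `bmFun n 1 = 1`. [folklore] -/
theorem bmFun_one {n : ℕ} (hn : n ≠ 0) : bmFun n 1 = 1 := by
  unfold bmFun
  rw [rpow_one]
  exact div_self (mul_pos (by positivity) (prodGamma_pos n (by positivity))).ne'

/-- `bmFun n (s + 1) = s · bmFun n s` for `s > 0`. [folklore] -/
theorem bmFun_add_one {n : ℕ} (hn : n ≠ 0) {s : ℝ} (hs : 0 < s) :
    bmFun n (s + 1) = s * bmFun n s := by
  unfold bmFun
  have hn' : (0 : ℝ) < n := by positivity
  rw [add_div, prodGamma_add_inv hn (div_pos hs hn'), rpow_add hn', rpow_one]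
  field_simp

/-- `bmFun n s > 0` for `s > 0`. [folklore] -/
theorem bmFun_pos {n : ℕ} (hn : n ≠ 0) {s : ℝ} (hs : 0 < s) : 0 < bmFun n s := by
  unfold bmFun
  have hn' : (0 : ℝ) < n := by positivity
  exact div_pos (mul_pos (rpow_pos_of_pos hn' _) (prodGamma_pos n (div_pos hs hn')))
    (mul_pos hn' (prodGamma_pos n (by positivity)))

/-- Precomposition of a convex function on `(0, ∞)` with `s ↦ s/a + b`, `a > 0`, `b ≥ 0`, is
convex on `(0, ∞)`. [folklore] -/
theorem convexOn_comp_div_add {f : ℝ → ℝ} (hf : ConvexOn ℝ (Ioi 0) f) {a b : ℝ} (ha : 0 < a)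
    (hb : 0 ≤ b) : ConvexOn ℝ (Ioi 0) (fun s => f (s / a + b)) := by
  refine ⟨convex_Ioi 0, fun x hx y hy p q hp hq hpq => ?_⟩
  have hx' : x / a + b ∈ Ioi (0 : ℝ) := by
    simp only [Set.mem_Ioi] at hx ⊢; positivity
  have hy' : y / a + b ∈ Ioi (0 : ℝ) := by
    simp only [Set.mem_Ioi] at hy ⊢; positivity
  have := hf.2 hx' hy' hp hq hpq
  calc f ((p • x + q • y) / a + b) = f (p • (x / a + b) + q • (y / a + b)) := by
        congr 1; simp only [smul_eq_mul]; linear_combination (-b) * hpq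
    _ ≤ p • f (x / a + b) + q • f (y / a + b) := this

/-- A finite sum of convex functions is convex. [folklore] -/
theorem convexOn_finset_sum {ι : Type*} (t : Finset ι) {f : ι → ℝ → ℝ} {S : Set ℝ}
    (hS : Convex ℝ S) (h : ∀ i ∈ t, ConvexOn ℝ S (f i)) :
    ConvexOn ℝ S (fun x => ∑ i ∈ t, f i x) := by
  classical
  induction t using Finset.induction_on with
  | empty => simpa using convexOn_const (0 : ℝ) hS
  | @insert a t hat ih =>
    simp_rw [sum_insert hat]
    change ConvexOn ℝ S ((f a) + fun x => ∑ i ∈ t, f i x)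
    exact (h a (mem_insert_self _ _)).add (ih fun i hi => h i (mem_insert_of_mem hi))

/-- `log ∘ bmFun n` is convex on `(0, ∞)` (sum of translates of the convex `log ∘ Γ` and a
linear term). [folklore] -/
theorem convexOn_log_bmFun {n : ℕ} (hn : n ≠ 0) : ConvexOn ℝ (Ioi 0) (log ∘ bmFun n) := by
  have hn' : (0 : ℝ) < n := by positivity
  have hD : 0 < (n : ℝ) * prodGamma n (1 / n) := mul_pos hn' (prodGamma_pos n (by positivity))
  have heq : EqOn (log ∘ bmFun n)
      (fun s => s * log n + ∑ k ∈ range n, log (Gamma (s / n + k / n))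
        + -log (n * prodGamma n (1 / n))) (Ioi 0) := by
    intro s hs
    have hs' : 0 < s / n := div_pos hs hn'
    have hG : ∀ k ∈ range n, Gamma (s / n + k / n) ≠ 0 :=
      fun k _ => (Gamma_pos_of_pos (by positivity)).ne'
    simp only [Function.comp_apply, bmFun]
    rw [log_div (mul_pos (rpow_pos_of_pos hn' _) (prodGamma_pos n hs')).ne' hD.ne',
      log_mul (rpow_pos_of_pos hn' _).ne' (prodGamma_pos n hs').ne', log_rpow hn', prodGamma,
      log_prod hG, sub_eq_add_neg]
  refine ConvexOn.congr ?_ heq.symm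
  refine ConvexOn.add_const ?_ _
  refine ConvexOn.add ?_ ?_
  · exact ⟨convex_Ioi 0, fun x _ y _ a b _ _ _ => by
      simp only [smul_eq_mul]; exact le_of_eq (by ring)⟩
  · refine convexOn_finset_sum (range n) (convex_Ioi 0)
      (f := fun (k : ℕ) (s : ℝ) => log (Gamma (s / n + k / n))) fun k _ => ?_
    exact convexOn_comp_div_add convexOn_log_Gamma hn' (by positivity)

/-- Step 1: `bmFun n = Γ` on `(0, ∞)` (Bohr–Mollerup), i.e. (1.5.2) for real positive argument
with the constant `P` of (1.5.3) in place of `(2π)^{(n-1)/2} n^{-1/2}`.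
[cite: AndrewsAskeyRoy1999, §1.5, proof of Thm 1.5.2] -/
theorem bmFun_eq_Gamma {n : ℕ} (hn : n ≠ 0) {s : ℝ} (hs : 0 < s) : bmFun n s = Gamma s :=
  eq_Gamma_of_log_convex (convexOn_log_bmFun hn) (fun hy => bmFun_add_one hn hy)
    (fun hy => bmFun_pos hn hy) (bmFun_one hn) hs

/-! ### Steps 1+2: the real formula for positive argument -/

/-- The constant: `n ∏_{k<n} Γ(1/n + k/n) = √n (2π)^{(n-1)/2}` (AAR (1.5.3) times `n Γ(1)`).
[cite: AndrewsAskeyRoy1999, §1.5, (1.5.3)] -/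
theorem const_eq {n : ℕ} (hn : n ≠ 0) :
    (n : ℝ) * prodGamma n (1 / n) = Real.sqrt n * (2 * π) ^ (((n : ℝ) - 1) / 2) := by
  obtain ⟨m, rfl⟩ := Nat.exists_eq_succ_of_ne_zero hn
  have hP : prodGamma (m + 1) (1 / ((m.succ : ℕ) : ℝ)) = Real.sqrt ((2 * π) ^ m / (m + 1)) := by
    unfold prodGamma
    rw [prod_range_succ, ← prod_Gamma_div_eq m]
    have h1 : Gamma (1 / ((m.succ : ℕ) : ℝ) + ((m : ℕ) : ℝ) / ((m.succ : ℕ) : ℝ)) = 1 := by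
      rw [← add_div]; push_cast
      rw [show (1 : ℝ) + m = m + 1 by ring, div_self (by positivity), Gamma_one]
    rw [h1, mul_one]
    refine prod_congr rfl fun k _ => ?_
    congr 1; push_cast; ring
  rw [hP, Real.sqrt_div' _ (by positivity), Real.sqrt_eq_rpow ((2 * π) ^ m), ← Real.rpow_natCast,
    ← Real.rpow_mul (by positivity)]
  push_cast
  rw [show ((m : ℝ) + 1 - 1) / 2 = m * (1 / 2) by ring]
  have hs : 0 < Real.sqrt ((m : ℝ) + 1) := Real.sqrt_pos.mpr (by positivity)
  field_simp
  rw [Real.sq_sqrt (by positivity)]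

/-- Steps 1+2, real form: for `n ≥ 1` and real `x > 0`,
`(∏_{k<n} Γ(x + k/n)) · n^{nx} = Γ(nx) · √n · (2π)^{(n-1)/2}`.
[cite: AndrewsAskeyRoy1999, Thm 1.5.2] -/
theorem real_formula {n : ℕ} (hn : n ≠ 0) {x : ℝ} (hx : 0 < x) :
    prodGamma n x * (n : ℝ) ^ ((n : ℝ) * x)
      = Gamma (n * x) * Real.sqrt n * (2 * π) ^ (((n : ℝ) - 1) / 2) := by
  have hn' : (0 : ℝ) < n := by positivity
  have h := bmFun_eq_Gamma hn (mul_pos hn' hx)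
  unfold bmFun at h
  rw [div_eq_iff (mul_pos hn' (prodGamma_pos n (by positivity))).ne', const_eq hn,
    mul_div_cancel_left₀ _ hn'.ne'] at h
  linear_combination h

/-! ### Step 3: analytic continuation -/

/-- Step 3: for `n ≥ 1` and every `z ∈ ℂ`,
`∏_{k<n} Γ(z + k/n)⁻¹ = Γ(nz)⁻¹ · n^{nz} · (√n (2π)^{(n-1)/2})⁻¹` (no pole condition needed).
[cite: AndrewsAskeyRoy1999, Thm 1.5.2] -/
theorem complex_inv_formula {n : ℕ} (hn : n ≠ 0) (z : ℂ) :
    ∏ k ∈ range n, (Complex.Gamma (z + k / n))⁻¹ =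
      (Complex.Gamma (n * z))⁻¹ * (n : ℂ) ^ ((n : ℂ) * z) *
        ((Real.sqrt n : ℂ) * (2 * (π : ℂ)) ^ (((n : ℂ) - 1) / 2))⁻¹ := by
  have hn' : (n : ℂ) ≠ 0 := Nat.cast_ne_zero.mpr hn
  set C : ℂ := (Real.sqrt n : ℂ) * (2 * (π : ℂ)) ^ (((n : ℂ) - 1) / 2) with hC
  suffices H : (fun z : ℂ => ∏ k ∈ range n, (Complex.Gamma (z + k / n))⁻¹) =
      fun z => (Complex.Gamma (n * z))⁻¹ * (n : ℂ) ^ ((n : ℂ) * z) * C⁻¹ from congr_fun H z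
  have h1 : AnalyticOnNhd ℂ (fun z : ℂ => ∏ k ∈ range n, (Complex.Gamma (z + k / n))⁻¹) univ := by
    refine DifferentiableOn.analyticOnNhd ?_ isOpen_univ
    refine (Differentiable.fun_finsetProd fun k _ => ?_).differentiableOn
    exact Complex.differentiable_one_div_Gamma.comp (differentiable_id.add_const _)
  have h2 : AnalyticOnNhd ℂ
      (fun z => (Complex.Gamma (n * z))⁻¹ * (n : ℂ) ^ ((n : ℂ) * z) * C⁻¹) univ := by
    refine DifferentiableOn.analyticOnNhd ?_ isOpen_univ
    refine (Differentiable.mul ?_ (differentiable_const _)).differentiableOn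
    apply Differentiable.mul
    · exact Complex.differentiable_one_div_Gamma.comp (differentiable_id.const_mul _)
    · refine fun t => DifferentiableAt.const_cpow ?_ (Or.inl hn')
      exact differentiableAt_id.const_mul _
  have h3 : Tendsto ((↑) : ℝ → ℂ) (𝓝[≠] 1) (𝓝[≠] 1) := by
    rw [tendsto_nhdsWithin_iff]; constructor
    · exact tendsto_nhdsWithin_of_tendsto_nhds Complex.continuous_ofReal.continuousAt
    · exact eventually_nhdsWithin_iff.mpr
        (Eventually.of_forall fun t ht => Complex.ofReal_ne_one.mpr ht)
  refine AnalyticOnNhd.eq_of_frequently_eq h1 h2 (h3.frequently ?_)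
  refine ((Eventually.filter_mono nhdsWithin_le_nhds) ?_).frequently
  refine (eventually_gt_nhds zero_lt_one).mp (Eventually.of_forall fun t ht => ?_)
  have hcast : ∏ k ∈ range n, (Complex.Gamma ((t : ℂ) + k / n))⁻¹
      = ((prodGamma n t : ℝ) : ℂ)⁻¹ := by
    rw [prodGamma, Complex.ofReal_prod, ← prod_inv_distrib]
    refine prod_congr rfl fun k _ => ?_
    rw [← Complex.Gamma_ofReal]
    push_cast
    rfl
  have key : ((prodGamma n t : ℝ) : ℂ) = Complex.Gamma (n * t) * C / (n : ℂ) ^ ((n : ℂ) * t) := by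
    rw [eq_div_iff (Complex.cpow_ne_zero_iff.mpr (Or.inl hn'))]
    have := congr_arg ((↑) : ℝ → ℂ) (real_formula hn ht)
    simp only [Complex.ofReal_mul] at this
    rw [Complex.ofReal_cpow n.cast_nonneg, Complex.ofReal_cpow (by positivity : (0:ℝ) ≤ 2 * π),
      ← Complex.Gamma_ofReal] at this
    push_cast at this
    rw [this, hC]
    ring
  rw [hcast, key, div_eq_mul_inv, mul_inv, mul_inv, inv_inv]
  ring

end GaussMultiplication

/-- **Gauss's multiplication formula holds** (discharge of the named fact
`GaussMultiplicationFormula`). [cite: AndrewsAskeyRoy1999, Thm 1.5.2] -/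
theorem GaussMultiplicationFormula_holds : GaussMultiplicationFormula := by
  intro n z hn _
  have hn0 : n ≠ 0 := by omega
  have hn' : (n : ℂ) ≠ 0 := Nat.cast_ne_zero.mpr hn0
  set C : ℂ := (Real.sqrt n : ℂ) * (2 * (π : ℂ)) ^ (((n : ℂ) - 1) / 2) with hC
  have H := GaussMultiplication.complex_inv_formula hn0 z
  have h2pi0 : (2 * (π : ℂ)) ≠ 0 := by
    exact mul_ne_zero two_ne_zero (Complex.ofReal_ne_zero.mpr Real.pi_pos.ne')
  have hC0 : C ≠ 0 := by
    refine mul_ne_zero ?_ (Complex.cpow_ne_zero_iff.mpr (Or.inl h2pi0))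
    exact Complex.ofReal_ne_zero.mpr (Real.sqrt_pos.mpr (by positivity)).ne'
  have hnpow : (n : ℂ) ^ ((n : ℂ) * z) ≠ 0 := Complex.cpow_ne_zero_iff.mpr (Or.inl hn')
  rw [Finset.prod_inv_distrib] at H
  have H' : Complex.Gamma (n * z) =
      (∏ k ∈ Finset.range n, Complex.Gamma (z + k / n)) * ((n : ℂ) ^ ((n : ℂ) * z) * C⁻¹) := by
    have := congr_arg Inv.inv H
    rw [inv_inv, mul_assoc, mul_inv, inv_inv] at this
    rw [this, mul_assoc, inv_mul_cancel₀ (mul_ne_zero hnpow (inv_ne_zero hC0)), mul_one]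
  rw [H']
  have hsqrt : ((Real.sqrt n : ℝ) : ℂ) = (n : ℂ) ^ (1 / 2 : ℂ) := by
    rw [Real.sqrt_eq_rpow, Complex.ofReal_cpow n.cast_nonneg]
    push_cast
    rfl
  have h2pi : (2 * (π : ℂ)) ^ ((1 - (n : ℂ)) / 2) = ((2 * (π : ℂ)) ^ (((n : ℂ) - 1) / 2))⁻¹ := by
    rw [← Complex.cpow_neg]
    congr 1
    ring
  rw [h2pi, Complex.cpow_sub _ _ hn', hC, hsqrt, mul_inv, div_eq_mul_inv]
  ring

end Literature.Analysis.SpecialFunctions
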